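import Summits.QuantumFields.YangMills.Theses.FemtoCutoffLadder
import Summits.QuantumFields.YangMills.Theorems.FemtoTransferGapOneSiteScaling
import Summits.QuantumFields.YangMills.Theorems.FemtoTransferGapLevelsPos
import Summits.QuantumFields.YangMills.Theorems.FemtoTransferGapRungW1up
import Summits.QuantumFields.YangMills.Theorems.LuscherReductionOneSiteLevelsClosed
import Summits.QuantumFields.YangMills.Theorems.LuscherReductionRunningReductionCoarseUpperDefs

/-!
# Crux `FixedLatticeLaw` (stmt-QuantumFields-23943 ≡ tree leaf `FemtoGapFixedLattice`) DOMINATES route RED's open fixed-lattice target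
# `BOUpperAt L` at level `k = 1`, for every `L` — a kernel certificate for staffing (route `FemtoCutoffLadder`, lead seat `ym-line-fcl-p1` g2)

The route `LuscherReduction` (RED) runs a FIXED-LATTICE programme COARSE(L₀) (stub 3b′ of its KT door / S-BASE of crux `TwistedTraceScaling`
stmt-QuantumFields-20203): its Born–Oppenheimer comparison text is `BOUpperAt L` (`…RunningReductionCoarseUpperDefs`):
`∀ k, ∀ ε > 0, ∃ β₀, ∀ β ≥ β₀, λ_k(β,L)·μ₀(L³β) ≤ e^{ε·λ_b(L³β)}·μ_k(L³β)·λ₀(β,L)` — relative precision `o(λ_b(L³β)) = o(λ_b/L)` — and it is OPEN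
(reduced, kernel-checked, to the two open texts `VacuumFloorAt` + `InnerNoIntruderOneOrbitAt`, lanes A/B of fleet `ym-luscher-20007-p1`, ≥ 10
generations).  The crux child `FixedLatticeLaw` of THIS route (= `FemtoGapFixedLattice`, relative precision `O(λ_b²/L)`) is STRICTLY STRONGER at
`k = 1`: this file proves

* `boUpper_one_of_fixedLatticeLawAt` — the fixed-`L` law at ONE lattice size `L` (spelled out) ⟹ the `k = 1` clause of `BOUpperAt L` (spelled
  out verbatim): combine with crux ONE's LOWER half at the scaled coupling `L³β` (`oneSiteLevels_proof`, `μ₁ ≥ e^{−(ε₁w + Cw²)}μ₀`, `w = λ_b(L³β) =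
  λ_b(β)/L` by `bareLambda_cube_mul`) and absorb `(C_L·L + C)·w² ≤ ε·w` for `β` large (`bareLambda_le_of_le`);
* `boUpper_one_of_femtoGapFixedLattice` / `boUpper_one_of_fixedLatticeLaw` — the same from the leaf / from the route decl (`Iff.rfl`-equal).

The converse is NOT claimed and is not expected at this precision (`o(λ_b)` does not give `O(λ_b²)`); the Assembly of this route needs the
`O(λ_b²)` form at the tower base (the leaf `FemtoGapOfRecord` fixes `C` before `lam`).  READING FOR THE PLANNER/DIRECTOR: a seat on 23943 attacks a
statement above an open multi-seat programme of route RED at the same lattice sizes; pool them (one engine: the onion/valley/inner architecture of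
`…RunningReductionCoarseUpper*`, sharpened from `o(λ_b)` to `O(λ_b²)` scales).
HONEST FRAMING: bookkeeping between two open fixed-lattice statements; femto rung R2b1 (RECORD label) — not infinite volume, not a mass gap, not Clay.
No definitions, no named facts, no `sorry`.
-/

set_option autoImplicit false

noncomputable section

namespace Summit.QuantumFields.YangMills.Theorems.FemtoCutoffLadder

open Real
open Summit.QuantumFields.YangMills.Theorems.FemtoTransferGap
open Literature.Analysis.OperatorTheory.YMMatrixModel

/-- ★ **Fixed-`L` Lüscher law at `O(λ_b²)` ⟹ RED's `BOUpperAt L` at `k = 1`.**  If on the fixed lattice `(ℤ/L)³`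
`λ₁ ≤ exp(−(ε₁λ_b − C_Lλ_b²)/L)·λ₀` for `β ≥ β₀`, then for every `ε > 0`, eventually in `β`,
`λ₁(β,L)·μ₀(L³β) ≤ e^{ε·λ_b(L³β)}·μ₁(L³β)·λ₀(β,L)` (one-site levels `μ_j` at the scaled coupling `L³β`): crux ONE's lower half at `L³β`,
`λ_b(L³β) = λ_b(β)/L`, and `(|C_L|·L + |C|)·λ_b(L³β) ≤ ε` for large `β`. [cite: Luscher1983, §2–§3] [cite: LuscherMunster1984, §2] -/
theorem boUpper_one_of_fixedLatticeLawAt (L : ℕ) [NeZero L]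
    (hFL : ∃ C β0 : ℝ, ∀ β : ℝ, β0 ≤ β →
      secondValue su2Rep L β ≤
        Real.exp (-(luscherEps1 * bareLambda β - C * bareLambda β ^ 2) / L) * topValue su2Rep L β) :
    ∀ ε : ℝ, 0 < ε → ∃ β0 : ℝ, ∀ β : ℝ, β0 ≤ β →
      levelValue su2Rep L β 1 * levelValue su2Rep 1 ((L : ℝ) ^ 3 * β) 0 ≤
        Real.exp (ε * bareLambda ((L : ℝ) ^ 3 * β)) *
          (levelValue su2Rep 1 ((L : ℝ) ^ 3 * β) 1 * levelValue su2Rep L β 0) := by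
  intro ε hε
  obtain ⟨C₁, β₁, h₁⟩ := hFL
  obtain ⟨C₂, B₂, h₂⟩ := oneSiteLevels_proof 1
  -- the absorbing threshold: w = λ_b(L³β) ≤ t := ε / (|C₁| L + |C₂| + 1)
  set K : ℝ := |C₁| * L + |C₂| + 1 with hK
  have hL1 : (1 : ℝ) ≤ L := by exact_mod_cast NeZero.one_le
  have hL : (0 : ℝ) < L := by linarith
  have hKpos : 0 < K := by rw [hK]; positivity
  set t : ℝ := ε / K with ht
  have htpos : 0 < t := div_pos hε hKpos
  -- thresholds: β ≥ β₁ (fixed-L law), L³β ≥ B₂ (ONE), L³β ≥ 2/t³ (absorption), β ≥ 1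
  refine ⟨max (max β₁ 1) (max B₂ (2 / t ^ 3)), fun β hβ => ?_⟩
  have hβ1 : β₁ ≤ β := (le_max_left _ _).trans ((le_max_left _ _).trans hβ)
  have hβone : (1 : ℝ) ≤ β := (le_max_right _ _).trans ((le_max_left _ _).trans hβ)
  have hβ0 : 0 < β := by linarith
  have hL3 : (1 : ℝ) ≤ (L : ℝ) ^ 3 := one_le_pow₀ hL1
  have hBge : β ≤ (L : ℝ) ^ 3 * β := le_mul_of_one_le_left hβ0.le hL3
  have hB2 : B₂ ≤ (L : ℝ) ^ 3 * β := ((le_max_left _ _).trans ((le_max_right _ _).trans hβ)).trans hBge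
  have hBt : 2 / t ^ 3 ≤ (L : ℝ) ^ 3 * β := ((le_max_right _ _).trans ((le_max_right _ _).trans hβ)).trans hBge
  have hBpos : 0 < (L : ℝ) ^ 3 * β := by positivity
  -- names
  set B : ℝ := (L : ℝ) ^ 3 * β with hBdef
  set μ0 := levelValue su2Rep 1 B 0
  set μ1 := levelValue su2Rep 1 B 1
  set v := bareLambda β with hv
  set w := bareLambda B with hw
  have hvw : w = v / L := by rw [hw, hv, hBdef]; exact bareLambda_cube_mul hβ0 L
  have hwpos : 0 < w := bareLambda_pos' hBpos
  have hwt : w ≤ t := bareLambda_le_of_le htpos hBt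
  -- the two inputs
  have H₁ : levelValue su2Rep L β 1 ≤ Real.exp (-(luscherEps1 * v - C₁ * v ^ 2) / L) * levelValue su2Rep L β 0 := by
    rw [levelValue_one, levelValue_zero]; exact h₁ β hβ1
  obtain ⟨hμ0, -, hlow⟩ := h₂ B hB2
  rw [levelGap_one] at hlow
  -- hlow : exp(−(ε₁ w + C₂ w²)) μ0 ≤ μ1
  have htop0 : 0 ≤ levelValue su2Rep L β 0 := by rw [levelValue_zero]; exact (topValue_su2Rep_pos L β).le
  have hμ1 : 0 ≤ μ1 := (mul_pos (Real.exp_pos _) hμ0).le.trans hlow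
  -- Step 1: λ₁ μ0 ≤ exp(−(ε₁v − C₁v²)/L) λ₀ μ0 ≤ exp(−(ε₁v − C₁v²)/L) λ₀ · exp(ε₁w + C₂w²) μ1
  have hμ0le : μ0 ≤ Real.exp (luscherEps1 * w + C₂ * w ^ 2) * μ1 := by
    have hexp : 0 < Real.exp (-(luscherEps1 * w + C₂ * w ^ 2)) := Real.exp_pos _
    have := mul_le_mul_of_nonneg_left hlow (Real.exp_pos (luscherEps1 * w + C₂ * w ^ 2)).le
    rw [← mul_assoc, ← Real.exp_add] at this
    have e0 : luscherEps1 * w + C₂ * w ^ 2 + -(luscherEps1 * w + C₂ * w ^ 2) = 0 := by ring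
    rw [e0, Real.exp_zero, one_mul] at this
    exact this
  have step : levelValue su2Rep L β 1 * μ0 ≤
      (Real.exp (-(luscherEps1 * v - C₁ * v ^ 2) / L) * Real.exp (luscherEps1 * w + C₂ * w ^ 2)) *
        (μ1 * levelValue su2Rep L β 0) := by
    calc levelValue su2Rep L β 1 * μ0
        ≤ (Real.exp (-(luscherEps1 * v - C₁ * v ^ 2) / L) * levelValue su2Rep L β 0) * μ0 :=
          mul_le_mul_of_nonneg_right H₁ hμ0.le
      _ ≤ (Real.exp (-(luscherEps1 * v - C₁ * v ^ 2) / L) * levelValue su2Rep L β 0) *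
            (Real.exp (luscherEps1 * w + C₂ * w ^ 2) * μ1) :=
          mul_le_mul_of_nonneg_left hμ0le (mul_nonneg (Real.exp_pos _).le htop0)
      _ = _ := by ring
  -- Step 2: the exponent is (C₁ L + C₂) w² ≤ K w · w ≤ K t w = ε w
  have hE : Real.exp (-(luscherEps1 * v - C₁ * v ^ 2) / L) * Real.exp (luscherEps1 * w + C₂ * w ^ 2) ≤
      Real.exp (ε * w) := by
    rw [← Real.exp_add, Real.exp_le_exp]
    have hvL : v = L * w := by rw [hvw]; field_simp
    have e1 : -(luscherEps1 * v - C₁ * v ^ 2) / (L : ℝ) + (luscherEps1 * w + C₂ * w ^ 2) = (C₁ * L + C₂) * w ^ 2 := by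
      rw [hvL]; field_simp; ring
    rw [e1]
    have hcoef : C₁ * L + C₂ ≤ K := by
      rw [hK]
      have a1 : C₁ * (L : ℝ) ≤ |C₁| * L := mul_le_mul_of_nonneg_right (le_abs_self _) hL.le
      have a2 : C₂ ≤ |C₂| := le_abs_self _
      linarith
    have hw2 : 0 ≤ w ^ 2 := sq_nonneg w
    calc (C₁ * L + C₂) * w ^ 2 ≤ K * w ^ 2 := mul_le_mul_of_nonneg_right hcoef hw2
      _ = (K * w) * w := by ring
      _ ≤ (K * t) * w := mul_le_mul_of_nonneg_right (mul_le_mul_of_nonneg_left hwt hKpos.le) hwpos.le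
      _ = ε * w := by rw [ht]; field_simp
  calc levelValue su2Rep L β 1 * μ0
      ≤ (Real.exp (-(luscherEps1 * v - C₁ * v ^ 2) / L) * Real.exp (luscherEps1 * w + C₂ * w ^ 2)) *
          (μ1 * levelValue su2Rep L β 0) := step
    _ ≤ Real.exp (ε * w) * (μ1 * levelValue su2Rep L β 0) :=
        mul_le_mul_of_nonneg_right hE (mul_nonneg hμ1 htop0)

/-- ★ **Leaf form**: `FemtoGapFixedLattice` ⟹ for every `L` the `k = 1` clause of RED's `BOUpperAt L`. [cite: Luscher1983, §3] -/
theorem boUpper_one_of_femtoGapFixedLattice (h : FemtoGapFixedLattice) (L : ℕ) [NeZero L] :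
    ∀ ε : ℝ, 0 < ε → ∃ β0 : ℝ, ∀ β : ℝ, β0 ≤ β →
      levelValue su2Rep L β 1 * levelValue su2Rep 1 ((L : ℝ) ^ 3 * β) 0 ≤
        Real.exp (ε * bareLambda ((L : ℝ) ^ 3 * β)) *
          (levelValue su2Rep 1 ((L : ℝ) ^ 3 * β) 1 * levelValue su2Rep L β 0) :=
  boUpper_one_of_fixedLatticeLawAt L (h L)

/-- ★ **Route form**: the crux child `FixedLatticeLaw` (stmt-QuantumFields-23943, `Iff.rfl`-equal to the leaf) ⟹ for every `L` the `k = 1`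
clause of RED's open Born–Oppenheimer text `BOUpperAt L` — the crux sits ABOVE route RED's fixed-lattice programme at level one.
[cite: Luscher1983, §3] [cite: LuscherMunster1984, §2] -/
theorem boUpper_one_of_fixedLatticeLaw (h : Summit.QuantumFields.YangMills.Theses.FemtoCutoffLadder.FixedLatticeLaw)
    (L : ℕ) [NeZero L] :
    ∀ ε : ℝ, 0 < ε → ∃ β0 : ℝ, ∀ β : ℝ, β0 ≤ β →
      levelValue su2Rep L β 1 * levelValue su2Rep 1 ((L : ℝ) ^ 3 * β) 0 ≤
        Real.exp (ε * bareLambda ((L : ℝ) ^ 3 * β)) *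
          (levelValue su2Rep 1 ((L : ℝ) ^ 3 * β) 1 * levelValue su2Rep L β 0) :=
  boUpper_one_of_fixedLatticeLawAt L (h L)

end Summit.QuantumFields.YangMills.Theorems.FemtoCutoffLadder

end
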